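import Mathlib
import HarnessLib

/-!
# Cauchy–Schwarz and a Hardy-type inequality for interval integrals

Analysis/Calculus support file (everything proved, no definitions):

* `le_sqrt_mul_sqrt_of_forall_pos` — the optimisation lemma `(∀ λ > 0, 2c ≤ λA + B/λ) → c ≤ √A √B`;
* `abs_intervalIntegral_mul_le_sqrt` — Cauchy–Schwarz `|∫_u^v f g| ≤ √(∫ f²) √(∫ g²)` for continuous
  `f, g` (`u ≤ v`), without going through `MeasureTheory.MemLp`;
* `intervalIntegral_mul_sq_le_of_apply_eq_zero` — the elementary Hardy/Poincaré inequality with a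
  weight: if `h ∈ C¹`, `h(a) = 0`, `V ≥ 0` continuous and `b ≤ a`, then
  `∫_b^a V h² ≤ (∫_b^a (a − x) V(x) dx) · ∫_b^a h'²`
  (from `h(x)² = (∫_x^a h')² ≤ (a − x) ∫_x^a h'²`). With `∫ (a − x)V` small this says that the potential
  energy of a function vanishing at the edge is dominated by its kinetic energy — the coercivity
  input of the near-horizon channel estimate for `FixedModeChannels` (route PhotonSphereChannels,
  stmt-FinalStateConjecture-10048), where `V` is the exponentially small tail of the Regge–Wheeler
  potential.

Folklore.
-/

noncomputable section

namespace Literature.Analysis.Calculus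

open MeasureTheory Set Filter Topology intervalIntegral

/-- If `2c ≤ λ A + B/λ` for all `λ > 0` (`A, B ≥ 0`), then `c ≤ √A · √B`. [folklore] -/
theorem le_sqrt_mul_sqrt_of_forall_pos {A B c : ℝ} (hA : 0 ≤ A) (hB : 0 ≤ B)
    (h : ∀ lam : ℝ, 0 < lam → 2 * c ≤ lam * A + B / lam) : c ≤ Real.sqrt A * Real.sqrt B := by
  rcases hA.lt_or_eq with hA' | hA'
  · rcases hB.lt_or_eq with hB' | hB'
    · have hl : 0 < Real.sqrt B / Real.sqrt A := div_pos (Real.sqrt_pos.2 hB') (Real.sqrt_pos.2 hA')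
      have := h _ hl
      have hsA : Real.sqrt A ≠ 0 := (Real.sqrt_pos.2 hA').ne'
      have hsB : Real.sqrt B ≠ 0 := (Real.sqrt_pos.2 hB').ne'
      have e1 : Real.sqrt B / Real.sqrt A * A = Real.sqrt A * Real.sqrt B := by
        field_simp
        rw [Real.sq_sqrt hA]
      have e2 : B / (Real.sqrt B / Real.sqrt A) = Real.sqrt A * Real.sqrt B := by
        field_simp
        rw [Real.sq_sqrt hB]
      rw [e1, e2] at this
      linarith
    · -- `B = 0`: let `λ → 0`
      subst hB'
      rw [Real.sqrt_zero, mul_zero]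
      rcases le_or_gt c 0 with hc | hc
      · exact hc
      · have := h (c / A) (div_pos hc hA')
        rw [zero_div, add_zero, div_mul_cancel₀ _ hA'.ne'] at this
        linarith
  · -- `A = 0`: let `λ → ∞`
    subst hA'
    rw [Real.sqrt_zero, zero_mul]
    rcases le_or_gt c 0 with hc | hc
    · exact hc
    · rcases hB.lt_or_eq with hB' | hB'
      · have := h (B / c) (div_pos hB' hc)
        rw [mul_zero, zero_add, div_div_cancel₀ hB'.ne'] at this
        linarith
      · subst hB'
        have := h 1 one_pos
        simp at this
        linarith

/-- **Cauchy–Schwarz for interval integrals** of continuous functions (`u ≤ v`):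
`|∫_u^v f g| ≤ √(∫_u^v f²) √(∫_u^v g²)`. [folklore] -/
theorem abs_intervalIntegral_mul_le_sqrt {f g : ℝ → ℝ} (hf : Continuous f) (hg : Continuous g)
    {u v : ℝ} (huv : u ≤ v) :
    |∫ x in u..v, f x * g x| ≤ Real.sqrt (∫ x in u..v, f x ^ 2) * Real.sqrt (∫ x in u..v, g x ^ 2) := by
  have hA : 0 ≤ ∫ x in u..v, f x ^ 2 := intervalIntegral.integral_nonneg huv fun x _ => by positivity
  have hB : 0 ≤ ∫ x in u..v, g x ^ 2 := intervalIntegral.integral_nonneg huv fun x _ => by positivity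
  refine le_sqrt_mul_sqrt_of_forall_pos hA hB fun lam hlam => ?_
  have habs : |∫ x in u..v, f x * g x| ≤ ∫ x in u..v, |f x * g x| :=
    intervalIntegral.abs_integral_le_integral_abs huv
  have hpt : ∀ x, 2 * |f x * g x| ≤ lam * f x ^ 2 + g x ^ 2 / lam := by
    intro x
    have hsq : 0 ≤ (Real.sqrt lam * |f x| - |g x| / Real.sqrt lam) ^ 2 := sq_nonneg _
    have hsl : Real.sqrt lam ^ 2 = lam := Real.sq_sqrt hlam.le
    have hsl0 : Real.sqrt lam ≠ 0 := (Real.sqrt_pos.2 hlam).ne'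
    have hp2 : (Real.sqrt lam * |f x|) ^ 2 = lam * f x ^ 2 := by rw [mul_pow, hsl, sq_abs]
    have hq2 : (|g x| / Real.sqrt lam) ^ 2 = g x ^ 2 / lam := by rw [div_pow, hsl, sq_abs]
    have hpq : (Real.sqrt lam * |f x|) * (|g x| / Real.sqrt lam) = |f x| * |g x| := by
      field_simp
    rw [sub_sq, hp2, hq2, mul_assoc, hpq] at hsq
    rw [abs_mul]
    linarith
  have hint : 2 * ∫ x in u..v, |f x * g x| ≤ lam * (∫ x in u..v, f x ^ 2) + (∫ x in u..v, g x ^ 2) / lam := by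
    rw [← intervalIntegral.integral_const_mul, ← intervalIntegral.integral_const_mul, div_eq_inv_mul,
      ← intervalIntegral.integral_const_mul, ← intervalIntegral.integral_add]
    · refine intervalIntegral.integral_mono_on huv ?_ ?_ fun x _ => ?_
      · exact ((hf.mul hg).abs.const_mul 2).intervalIntegrable _ _
      · exact (((hf.pow 2).const_mul lam).add ((hg.pow 2).const_mul _)).intervalIntegrable _ _
      · have := hpt x
        rw [div_eq_inv_mul] at this
        linarith
    · exact ((hf.pow 2).const_mul lam).intervalIntegrable _ _
    · exact ((hg.pow 2).const_mul _).intervalIntegrable _ _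
  linarith


/-- **Hardy/Poincaré inequality with a weight, vanishing at the right endpoint.** For `h ∈ C¹` with
`h(a) = 0`, `V ≥ 0` continuous and `b ≤ a`:
`∫_b^a V h² ≤ (∫_b^a (a − x)V(x) dx) · ∫_b^a h'²`. [folklore] -/
theorem intervalIntegral_mul_sq_le_of_apply_eq_zero {V h h' : ℝ → ℝ} (hV : Continuous V)
    (hV0 : ∀ x, 0 ≤ V x) (hh : ∀ x, HasDerivAt h (h' x) x) (hh' : Continuous h') {b a : ℝ}
    (hba : b ≤ a) (h0 : h a = 0) :
    ∫ x in b..a, V x * h x ^ 2 ≤ (∫ x in b..a, (a - x) * V x) * ∫ x in b..a, h' x ^ 2 := by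
  set D : ℝ := ∫ x in b..a, h' x ^ 2 with hD
  have hD0 : 0 ≤ D := intervalIntegral.integral_nonneg hba fun x _ => by positivity
  have hcont_h : Continuous h := continuous_iff_continuousAt.2 fun x => (hh x).continuousAt
  -- pointwise: `h x ^ 2 ≤ (a - x) * D` on `[b, a]`
  have hpt : ∀ x ∈ Icc b a, h x ^ 2 ≤ (a - x) * D := by
    intro x hx
    have hftc : ∫ y in x..a, h' y = h a - h x :=
      integral_eq_sub_of_hasDerivAt (fun y _ => hh y) (hh'.intervalIntegrable _ _)
    have hx2 : h x ^ 2 = (∫ y in x..a, 1 * h' y) ^ 2 := by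
      simp only [one_mul, hftc, h0, zero_sub, even_two.neg_pow]
    have hcs := abs_intervalIntegral_mul_le_sqrt (f := fun _ => (1 : ℝ)) (g := h') continuous_const
      hh' hx.2
    have hone : (∫ y in x..a, (1 : ℝ) ^ 2) = a - x := by simp
    have hsub : (∫ y in x..a, h' y ^ 2) ≤ D :=
      intervalIntegral.integral_mono_interval hx.1 hx.2 le_rfl
        (Eventually.of_forall fun y => by positivity)
        ((show Continuous fun y => h' y ^ 2 from hh'.pow 2).intervalIntegrable b a)
    have hI0 : 0 ≤ ∫ y in x..a, h' y ^ 2 := intervalIntegral.integral_nonneg hx.2 fun y _ => by positivity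
    rw [hone] at hcs
    calc h x ^ 2 = |∫ y in x..a, 1 * h' y| ^ 2 := by rw [hx2, sq_abs]
      _ ≤ (Real.sqrt (a - x) * Real.sqrt (∫ y in x..a, h' y ^ 2)) ^ 2 :=
          pow_le_pow_left₀ (abs_nonneg _) hcs 2
      _ = (a - x) * ∫ y in x..a, h' y ^ 2 := by
          rw [mul_pow, Real.sq_sqrt (by linarith [hx.2]), Real.sq_sqrt hI0]
      _ ≤ (a - x) * D := mul_le_mul_of_nonneg_left hsub (by linarith [hx.2])
  -- integrate against `V ≥ 0`
  calc (∫ x in b..a, V x * h x ^ 2) ≤ ∫ x in b..a, (a - x) * V x * D := by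
        refine intervalIntegral.integral_mono_on hba ?_ ?_ fun x hx => ?_
        · exact (hV.mul (hcont_h.pow 2)).intervalIntegrable _ _
        · exact (((continuous_const.sub continuous_id).mul hV).mul continuous_const).intervalIntegrable _ _
        · have := mul_le_mul_of_nonneg_left (hpt x hx) (hV0 x)
          nlinarith
    _ = (∫ x in b..a, (a - x) * V x) * D := by
        rw [intervalIntegral.integral_mul_const]

end Literature.Analysis.Calculus
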